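import Summits.AtomisticToContinuum.Crystallization.Theses.GappedShellCensus
import Summits.AtomisticToContinuum.Crystallization.Theorems.RadialDefectsVanish.Negative.FalseWithoutGS

/-!
# Disproof of `CleanLimitExtractionR` (stmt-AtomisticToContinuum-18072) — findings

Crux (route `GappedShellCensus`, rank 9, the REPAIRED bridge after the refutation of `ShellCensus`):
`CleanLimitExtractionR := RadialDefectsVanish → ShellTrichotomy → TornFree → FiveFoldRationingR →
CleanLocalLimit`.

## Verdict of the disprover (cycle 1, 2026-08-17): NO KILL POSSIBLE — the crux is KERNEL-PROVED.

* **Decisive fact.** The crux workfile `Cruxes/CleanLimitExtractionR/SketchIdeator2.lean`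
  (crux-ideate, ideator 2) contains `IdeatorTwo.cleanLimitExtractionR_candidate : CleanLimitExtractionR`
  (and a second composition `cleanLimitExtractionR_via_counts`).  Re-checked BY THIS SEAT on the farm
  against the rev-5 route file: rc 0, 0 `sorry`, `#print axioms` = `[propext, Classical.choice,
  Quot.sound]`, H21 audit `proof-of-item … closed: true` for
  `Summit.AtomisticToContinuum.Crystallization.Theses.GappedShellCensus.CleanLimitExtractionR`.
  Lean being consistent, `¬ CleanLimitExtractionR` is unprovable; what remains is the lead's PORT
  (PICKED.md: strip the nine `def … : Prop` helpers, split into stubs A–D, land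
  `Theorems/GappedShellCensusCleanLimitExtractionR.lean`).
* **Shape of the crux** (`cleanLimitExtractionR_iff`, `Iff.rfl`, landed in
  `Theorems/CleanLimitExtractionR/Negative/ConclusionNotFree.lean`, p135151): an implication between
  CLOSED propositions.  A refutation would need proofs of all four antecedents AND `¬ CleanLocalLimit`;
  the four antecedents are open (`ledger negatives --problem AtomisticToContinuum`, 2026-08-17: among
  the route's items only the DROPPED `ShellCensus` (stmt-15929) is refuted), so — unlike the
  pre-repair bridge stmt-15933, which closed ex falso from `¬ ShellCensus` — there is no vacuous proof
  either; the candidate proof is a genuine extraction.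
* **Load-bearing analysis (what any proof must use).**
  - `RadialDefectsVanish` (the only antecedent mentioning the given sequence `x`): LOAD-BEARING —
    `conclusion_false_without_GS` below (= landed
    `CleanLimitExtractionR.Negative.cleanLocalLimit_conclusion_false_without_GS`): with every
    hypothesis on `x` dropped the conclusion is false (the dilated line `x N i = 2i·e₀` has no clean
    local limit: two shell neighbours of `0`, `1/10`-matched to a translate of the line, give three
    naturals pairwise differing by one).  [The pre-repair copy
    `Theorems/CleanLimitExtraction/Negative/ConclusionNotFree.lean` mentions the dropped decls
    `CleanLimitExtraction`/`ShellCensus` and NO LONGER ELABORATES against rev 5 (farm rc 1, unknown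
    identifier) — hence the def-free re-landing under this crux's name.]
  - `ShellTrichotomy`, `TornFree`, `FiveFoldRationingR`: `_false_without_` theorems are NOT
    available in Lean for a glue of this shape (each needs proofs of the remaining open antecedents).
    What the candidate proof CONSUMES of them is only the alphabet-free rationing
    `GappedRationing` ("a non-empty all-gapped-twelve `Y` has fcc/hcp-clean balls of every radius"):
    `gappedRationing_of_trichotomy : ShellTrichotomy → TornFree → FiveFoldRationingR → GappedRationing`
    (TornFree `≥ 4` + FiveFoldRationingR `≤ 4` on balls ⇒ every bond there has EXACTLY four common
    neighbours ⇒ branches (B) `≥ 5` and (C) `≤ 3` of the trichotomy are excluded by the bookkeeping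
    identity `shellDegree_eq_commonNbrs` ⇒ branch (A)).  So for the ROUTE (planner information, not a
    defect of this crux): `TornFree` ("no torn bond ANYWHERE in ANY all-gapped-twelve `Y`") is much
    stronger than what the bridge eats (torn-and-capped-free balls of every radius in ONE hull element
    of the ground states); a sparse-torn counterexample to `TornFree` would break the route item but
    not the mechanism, a periodic torn all-gapped crystal breaks both.
* **Bookkeeping risk named by the planner — discharged.**  (i) shell-degree of `a⁻¹(v − y)` in the
  rescaled shell `T` of `y` = common-neighbour count of the bond `(y, v)`: exact, because
  `w ↦ a⁻¹ • (w − y)` is injective and `dist (a⁻¹•(v−y)) (a⁻¹•(w−y)) = a⁻¹ · dist v w` with `a > 0`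
  (`a ≥ 47/50`), so `dist ≤ 1.02` upstairs iff `dist ≤ 1.02·a` downstairs — candidate lemma
  `shellDegree_eq_commonNbrs`, my paper check agrees symbol by symbol; (ii) the rescaled shell
  satisfies the three typing hypotheses of `ShellTrichotomy` (card 12 = injective image of an
  `ncard = 12` set, which is finite BECAUSE `ncard = 12 ≠ 0`; norms in `[0.98, 1.02]` from the radial
  clause at `y`; pairwise admissibility from the radial clause AT THE SHELL POINTS, which are sites
  of `Y`) — candidate lemma `rescaledShell_hyps`; (iii) no junk operators: `a⁻¹` with `a ≥ 47/50`,
  `Set.ncard` only on sets forced finite, `dist`/`‖·‖` on `EuclideanSpace`.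
* **Attacks run (all negative = no kill):** triviality tactics on the decl (rattack seat: simp/aesop
  time out, tauto/exact? fail); vacuity of antecedents (none refuted; `IsGroundState` satisfiable for
  all `N` by `LennardJonesGroundStatesExist_holds`, so `CleanLocalLimit` is not vacuously true);
  internal inconsistency of the conclusion (none: scale window `[47/50, 1] ∋ a⋆ ≈ 0.971`, the fcc/hcp
  nearest-neighbour distance for `lennardJones` with `r₀ = 1`; an all-clean infinite `Y` is
  geometrically consistent — fcc at scale `a⋆`); quantifier order (`∃ a ∀ θ ∃ᶠ N` in RDV feeds
  `∃ Y a … ∃ φ t` in CLL: ONE scale for the whole sequence, as the closedness step needs);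
  degenerate instances (`N = 0, 1`: harmless, limits run along `φ n → ∞`; finite `Y`: excluded, every
  site has twelve neighbours); bookkeeping mismatch between the trichotomy's (B)/(C) counts and the
  TornFree/FFR counts (none, see above).
* **Tree-health observations for the planner/gate (not this item):** after rev 5 dropped the decls
  `ShellCensus` and `CleanLimitExtraction`, three landed files no longer elaborate on the farm:
  `Theorems/GappedShellCensusShellCensusRefutation.lean` (the route's own negative edge; rc 1,
  unknown `…GappedShellCensus.ShellCensus`), `Theorems/CleanLimitExtraction/Negative/ConclusionNotFree.lean`
  (rc 1), and `Cruxes/CleanLimitExtraction/Disproof.lean` (imports the former's siblings).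

## Index
* §1 `cleanLimitExtractionR_iff'`, `conclusion_false_without_GS` (same statement and proof as the
  landed negative lemma, p135151)
* §2 `GappedRationing`, `cleanLimitExtractionR_of_factors` — the factorisation shape the candidate
  proof realises (statement-level; the two factors are proved in the crux workfile, not here)
* `-- Targets`: none yet (no skeleton registered; PICKED line = port of a complete candidate, its four
  stubs A–D are already sorry-free in the workfile)
-/

noncomputable section

namespace Summit.AtomisticToContinuum.Crystallization.Cruxes.CleanLimitExtractionR.Disproof

open Summit.AtomisticToContinuum.Crystallization.Theses.GappedShellCensus
open Summit.AtomisticToContinuum.Crystallization.Theorems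
open Literature.Geometry.DiscreteGeometry Literature.MathematicalPhysics.StatisticalMechanics
open Filter

local notation "E3" => EuclideanSpace ℝ (Fin 3)

/-! ## §1 Shape of the crux and the conclusion-side load-bearing lemma (landed, re-exported) -/

/-- The crux unfolds (`Iff.rfl`) to the four closed antecedents implying the conclusion of
`CleanLocalLimit` written out for one sequence `x` — landed as
`CleanLimitExtractionR.Negative.cleanLimitExtractionR_iff`. -/
theorem cleanLimitExtractionR_iff' :
    CleanLimitExtractionR ↔ (RadialDefectsVanish → ShellTrichotomy → TornFree → FiveFoldRationingR →
      CleanLocalLimit) :=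
  Iff.rfl

/-- **`RadialDefectsVanish` is load-bearing**: the conclusion of the bridge with every hypothesis
on `x` dropped is FALSE (dilated line).  Landed verbatim as
`CleanLimitExtractionR.Negative.cleanLocalLimit_conclusion_false_without_GS` (p135151,
`Theorems/CleanLimitExtractionR/Negative/ConclusionNotFree.lean`); the proof is repeated here so that
this workfile elaborates independently of the farm's build of that module. -/
theorem conclusion_false_without_GS :
    ¬ ∀ x : (N : ℕ) → (Fin N → EuclideanSpace ℝ (Fin 3)),
        ∃ (Y : Set (EuclideanSpace ℝ (Fin 3))) (a : ℝ), 47 / 50 ≤ a ∧ a ≤ 1 ∧ (0 : EuclideanSpace ℝ (Fin 3)) ∈ Y ∧ (∃ (φ : ℕ → ℕ) (t : ℕ → EuclideanSpace ℝ (Fin 3)), StrictMono φ ∧ ∀ R ε : ℝ, 0 < ε → ∀ᶠ n in Filter.atTop, (∀ y ∈ Y, ‖y‖ ≤ R → ∃ i : Fin (φ n), dist (x (φ n) i + t n) y ≤ ε) ∧ (∀ i : Fin (φ n), ‖x (φ n) i + t n‖ ≤ R → ∃ y ∈ Y, dist (x (φ n) i + t n) y ≤ ε)) ∧ ∀ y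 ∈ Y, ({w ∈ Y | w ≠ y ∧ dist y w ≤ a * (1 + 1 / 50)}.ncard = 12 ∧ ∀ w ∈ Y, w ≠ y → a * (1 - 1 / 50) ≤ dist y w ∧ (dist y w ≤ a * (1 + 1 / 50) ∨ a * (63 / 50) ≤ dist y w)) ∧ ∃ T : Finset (EuclideanSpace ℝ (Fin 3)), (↑T : Set (EuclideanSpace ℝ (Fin 3))) = (fun w => a⁻¹ • (w - y)) '' {w ∈ Y | w ≠ y ∧ dist y w ≤ a * (1 + 1 / 50)} ∧ (Literature.Geometry.DiscreteGeometry.ShellCloseTo (1 / 5) T Literature.Geometry.DiscreteGeometry.fccKissingPattern ∨ Literature.Geometry.DiscreteGeometry.ShellCloseTo (1 / 5) T Literature.Geometry.DiscreteGeometry.hcpKissingPattern) := by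
  intro h
  -- integer step: if `2|i - j| ∈ (0.7, 2.3)` for naturals `i, j`, then `i - j = ±1`
  -- (inlined; the landed copy in `CleanLimitExtraction.Negative` lives in a module that no longer
  -- elaborates against the rev-5 route file)
  have int_step : ∀ i j : ℕ, (0.7 : ℝ) < 2 * |(i : ℝ) - (j : ℝ)| → 2 * |(i : ℝ) - (j : ℝ)| < 2.3 →
      (i : ℤ) - (j : ℤ) = 1 ∨ (i : ℤ) - (j : ℤ) = -1 := by
    intro i j hlo hhi
    have hcast : (i : ℝ) - (j : ℝ) = (((i : ℤ) - (j : ℤ) : ℤ) : ℝ) := by push_cast; ring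
    rw [hcast] at hlo hhi
    generalize hm : (i : ℤ) - (j : ℤ) = m at hlo hhi
    rw [← Int.cast_abs] at hlo hhi
    have h1 : ((|m| : ℤ) : ℝ) < 2 := by linarith
    have h2 : (0 : ℝ) < ((|m| : ℤ) : ℝ) := by linarith
    have h3 : |m| < 2 := by exact_mod_cast h1
    have h4 : 0 < |m| := by exact_mod_cast h2
    rcases abs_cases m with ⟨h, _⟩ | ⟨h, _⟩ <;> rw [h] at h3 h4 <;> omega
  obtain ⟨Y, a, ha1, ha2, h0, ⟨φ, t, -, hlim⟩, hgood⟩ := h RadialDefectsVanish.Negative.dilatedLine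
  -- two distinct shell neighbours `w₁ ≠ w₂` of the origin
  obtain ⟨⟨hcount, hsep0⟩, -⟩ := hgood 0 h0
  have hS0 : {w ∈ Y | w ≠ 0 ∧ dist 0 w ≤ a * (1 + 1 / 50)}.ncard ≠ 0 := by rw [hcount]; norm_num
  have hS1 : 1 < {w ∈ Y | w ≠ 0 ∧ dist 0 w ≤ a * (1 + 1 / 50)}.ncard := by rw [hcount]; norm_num
  obtain ⟨w₁, hw₁Y, hw₁0, hw₁d⟩ := Set.nonempty_of_ncard_ne_zero hS0
  obtain ⟨w₂, ⟨hw₂Y, hw₂0, hw₂d⟩, hne⟩ := Set.exists_ne_of_one_lt_ncard hS1 w₁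
  have hsep01 : a * (1 - 1 / 50) ≤ dist 0 w₁ := (hsep0 w₁ hw₁Y hw₁0).1
  have hsep02 : a * (1 - 1 / 50) ≤ dist 0 w₂ := (hsep0 w₂ hw₂Y hw₂0).1
  obtain ⟨⟨-, hsep1⟩, -⟩ := hgood w₁ hw₁Y
  have hsep12 : a * (1 - 1 / 50) ≤ dist w₁ w₂ := (hsep1 w₂ hw₂Y hne).1
  have hup12 : dist w₁ w₂ ≤ dist 0 w₁ + dist 0 w₂ := by
    calc dist w₁ w₂ ≤ dist w₁ 0 + dist 0 w₂ := dist_triangle _ _ _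
      _ = dist 0 w₁ + dist 0 w₂ := by rw [dist_comm w₁ 0]
  -- matching at radius `51/50`, tolerance `1/10`, at SOME index `n`
  obtain ⟨n, hn1, -⟩ := (hlim (51 / 50) (1 / 10) (by norm_num)).exists
  have hnorm : ∀ w : EuclideanSpace ℝ (Fin 3), dist 0 w ≤ a * (1 + 1 / 50) → ‖w‖ ≤ 51 / 50 := by
    intro w hw
    rw [← dist_zero_right, dist_comm]
    nlinarith
  obtain ⟨i₀, hi₀⟩ := hn1 0 h0 (by norm_num)
  obtain ⟨i₁, hi₁⟩ := hn1 w₁ hw₁Y (hnorm w₁ hw₁d)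
  obtain ⟨i₂, hi₂⟩ := hn1 w₂ hw₂Y (hnorm w₂ hw₂d)
  -- particle distances are `2|i - j|`
  have hpart : ∀ i j : Fin (φ n),
      dist (RadialDefectsVanish.Negative.dilatedLine (φ n) i + t n)
        (RadialDefectsVanish.Negative.dilatedLine (φ n) j + t n) =
        2 * |((i : ℕ) : ℝ) - ((j : ℕ) : ℝ)| := by
    intro i j
    rw [dist_add_right, RadialDefectsVanish.Negative.dist_dilatedLine]
  -- |dist p q - dist y z| ≤ dist p y + dist q z
  have hkey : ∀ (p q y z : EuclideanSpace ℝ (Fin 3)), dist p y ≤ 1 / 10 → dist q z ≤ 1 / 10 →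
      dist y z - 2 / 10 ≤ dist p q ∧ dist p q ≤ dist y z + 2 / 10 := by
    intro p q y z hp hq
    have h := dist_dist_dist_le p q y z
    rw [Real.dist_eq] at h
    constructor <;> linarith [(abs_sub_le_iff.1 (h.trans (add_le_add hp hq))).1,
      (abs_sub_le_iff.1 (h.trans (add_le_add hp hq))).2]
  obtain ⟨l01, u01⟩ := hkey _ _ _ _ hi₀ hi₁
  obtain ⟨l02, u02⟩ := hkey _ _ _ _ hi₀ hi₂
  obtain ⟨l12, u12⟩ := hkey _ _ _ _ hi₁ hi₂
  rw [hpart] at l01 u01 l02 u02 l12 u12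
  have s01 := int_step (i₀ : ℕ) (i₁ : ℕ) (by nlinarith) (by nlinarith)
  have s02 := int_step (i₀ : ℕ) (i₂ : ℕ) (by nlinarith) (by nlinarith)
  have s12 := int_step (i₁ : ℕ) (i₂ : ℕ) (by nlinarith) (by nlinarith)
  omega

/-! ## §2 What the bridge consumes of the three geometric cruxes (factorisation shape) -/

/-- ALPHABET-FREE RATIONING — the only consequence of `ShellTrichotomy ∧ TornFree ∧
FiveFoldRationingR` the extraction uses: a non-empty all-gapped-twelve `Y` has fcc/hcp-clean balls
of every radius (same body as the crux workfile's `IdeatorTwo.GappedRationing`). -/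
def GappedRationing : Prop :=
  ∀ (Y : Set E3) (a : ℝ), 0 < a → Y.Nonempty →
    (∀ y ∈ Y, {w ∈ Y | w ≠ y ∧ dist y w ≤ a * (1 + 1 / 50)}.ncard = 12 ∧
      ∀ w ∈ Y, w ≠ y → a * (1 - 1 / 50) ≤ dist y w ∧
        (dist y w ≤ a * (1 + 1 / 50) ∨ a * (63 / 50) ≤ dist y w)) →
    ∀ R : ℝ, ∃ c ∈ Y, ∀ y ∈ Y, dist y c ≤ R →
      ∃ T : Finset E3, (↑T : Set E3) = (fun w => a⁻¹ • (w - y)) '' {w ∈ Y | w ≠ y ∧ dist y w ≤ a * (1 + 1 / 50)} ∧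
        (ShellCloseTo (1 / 5) T fccKissingPattern ∨ ShellCloseTo (1 / 5) T hcpKissingPattern)

/-- FACTORISATION SHAPE of the kernel-checked candidate: the bridge is the composition of
(1) the census-free extraction `GappedRationing → RadialDefectsVanish → CleanLocalLimit`
(workfile: `cleanLimitExtraction_via_hull`, ω-limit hull in the compact rubber space) and
(2) the new factor `ShellTrichotomy → TornFree → FiveFoldRationingR → GappedRationing`
(workfile: `gappedRationing_of_trichotomy`).  Recorded so that a planner restating any of the
three geometric cruxes sees what must survive: only (2). -/
theorem cleanLimitExtractionR_of_factors
    (h₁ : GappedRationing → RadialDefectsVanish → CleanLocalLimit)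
    (h₂ : ShellTrichotomy → TornFree → FiveFoldRationingR → GappedRationing) :
    CleanLimitExtractionR :=
  fun hRDV hST hTF hFFR => h₁ (h₂ hST hTF hFFR) hRDV

-- Targets
-- (none: no skeleton registered for this crux at cycle 1; the PICKED line is the port of a complete,
--  sorry-free candidate — stubs A `stub_cleR_gappedOfTendsto`, B `stub_cleR_fccHcpOfTendsto`,
--  C `stub_cleR_viaHull`, D `stub_cleR_trichotomyFactor` are all proved in the workfile.)

end Summit.AtomisticToContinuum.Crystallization.Cruxes.CleanLimitExtractionR.Disproof

end
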